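import Summits.CriticalPhenomena.Ising3DConformalLimit.Theorems.PlantedPinningGaussianPinningSaturationLatticeDecomposition

/-!
# Strategist census `s6` for crux `PinningEfficiencyDeficit` (item stmt-CriticalPhenomena-8451) — typed attempts

Second, independent strategy census (family `s`, seat `cstrat-stmt-CriticalPhenomena-8451-s6`).
Route `PlantedPinning`, sub-problem `Ising3DConformalLimit`. This file is a SCRATCH record of the
typed attempts quoted in `Cruxes/PinningEfficiencyDeficit/STRATEGY-CENSUS-s6.md`; it contains no
`sorry`, posits no facts, and proves only logic / finite algebra around the crux:

* `## Weaker intermediate`: `LatticeSaturation`, `NotSaturated`, `FrequentDeficit`;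
  `closes_of_notSaturated` (the route glue runs from `NotSaturated`) and
  `latticeSaturation_of_not_conjunct` (given the two other items, `NotSaturated` is also NECESSARY
  for the route to close) — so `NotSaturated` is exactly the weakest replacement of the crux inside
  this route; `notSaturated_iff_frequentDeficit`, `frequentDeficit_of_deficit`.
* `## Decomposition` / `## Strengthen`: `GapEffFloor` (floor on the NONLINEAR regression-gap
  efficiency of the landed linear-benchmark split `e = e^{lin} − e^{gap}`);
  `deficit_of_gapEffFloor` (unconditional, from the landed `stub_varianceSplit`,
  `stub_linEffLeOne`) and `gapEffFloor_of_deficit_of_riccati` (converse modulo the registered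
  Gaussian-side stub `LinRiccatiSaturation` of crux 8452) — the crux is, modulo B2, the statement
  that the planted regression `τ_P ↦ E⁺[M_L | σ_P = τ_P]` stays uniformly NON-AFFINE in the pin values;
  `LinEffDeficit` and `not_linEffDeficit_of_riccati` (the other disjunct of the trivial split is dead);
  the abstract Cauchy–Schwarz dual `sq_wcov_le_wvar_mul_wvar` behind the "anticorrelation" split of the
  SPATIAL slack.
* `## Transfer` / `## Negation`: the dimension/temperature-parametrised crux `DeficitAt d β` with
  `deficitAt_three_iff` (`Iff.rfl`).
-/

noncomputable section

namespace Summit.CriticalPhenomena.Ising3DConformalLimit.Cruxes.PinningEfficiencyDeficit.StrategistS6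

open scoped BigOperators Classical
open Finset MeasureTheory
open Literature.Probability.LatticeModels
open Summit.CriticalPhenomena.Ising3DConformalLimit.Theses.PlantedPinning
open Summit.CriticalPhenomena.Ising3DConformalLimit.PlantedPinningGaussianPinningSaturation

/-! ### 0. The crux over the landed named objects -/

/-- The crux unfolds (definitionally) to a deficit statement for `plantedEff`. -/
theorem deficit_iff :
    PinningEfficiencyDeficit ↔
      ∃ ε : ℝ, 0 < ε ∧ ∃ p₀ : ℝ, 0 < p₀ ∧ ∀ p : ℝ, 0 < p → p < p₀ → ∃ L₀ : ℕ, ∀ L ≥ L₀,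
        plantedEff L ⌈p * ((box 3 L).card : ℝ)⌉₊ ≤ 1 - ε :=
  Iff.rfl

/-! ### 1. Weaker intermediates (from the summit side) -/

/-- Unconditional lattice saturation `e_L(⌈pn⌉) → 1` (`L → ∞` then `p → 0⁺`). -/
def LatticeSaturation : Prop :=
  ∀ ε : ℝ, 0 < ε → ∃ p₀ : ℝ, 0 < p₀ ∧ ∀ p : ℝ, 0 < p → p < p₀ → ∃ L₀ : ℕ, ∀ L ≥ L₀,
    1 - ε ≤ plantedEff L ⌈p * ((box 3 L).card : ℝ)⌉₊

/-- The weakest replacement of the crux compatible with the route glue: saturation FAILS. -/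
def NotSaturated : Prop := ¬ LatticeSaturation

/-- `liminf`-type deficit: some `ε`, arbitrarily small `p`, and for those `p` arbitrarily large `L`
with `e_L(⌈pn⌉) < 1 − ε` (the crux has `∃ p₀ ∀ p < p₀` and `∀ L ≥ L₀` instead). -/
def FrequentDeficit : Prop :=
  ∃ ε : ℝ, 0 < ε ∧ ∀ p₀ : ℝ, 0 < p₀ → ∃ p : ℝ, 0 < p ∧ p < p₀ ∧ ∀ L₀ : ℕ, ∃ L : ℕ, L₀ ≤ L ∧
    plantedEff L ⌈p * ((box 3 L).card : ℝ)⌉₊ < 1 - ε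

theorem notSaturated_iff_frequentDeficit : NotSaturated ↔ FrequentDeficit := by
  unfold NotSaturated LatticeSaturation FrequentDeficit
  constructor
  · intro h
    push Not at h
    obtain ⟨ε, hε, h⟩ := h
    refine ⟨ε, hε, fun p₀ hp₀ => ?_⟩
    obtain ⟨p, hp, hpp, h⟩ := h p₀ hp₀
    refine ⟨p, hp, hpp, fun L₀ => ?_⟩
    obtain ⟨L, hL, hlt⟩ := h L₀
    exact ⟨L, hL, hlt⟩
  · rintro ⟨ε, hε, h⟩ hsat
    obtain ⟨p₀, hp₀, hs⟩ := hsat ε hε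
    obtain ⟨p, hp, hpp, h⟩ := h p₀ hp₀
    obtain ⟨L₀, hL₀⟩ := hs p hp hpp
    obtain ⟨L, hL, hlt⟩ := h L₀
    exact absurd (hL₀ L hL) (not_le.2 hlt)

/-- The crux implies the frequent deficit (with `ε/2`). -/
theorem frequentDeficit_of_deficit (hdef : PinningEfficiencyDeficit) : FrequentDeficit := by
  rw [deficit_iff] at hdef
  obtain ⟨ε, hε, p₀, hp₀, hd⟩ := hdef
  refine ⟨ε / 2, by linarith, fun p₁ hp₁ => ?_⟩
  have hmin : 0 < min p₀ p₁ := lt_min hp₀ hp₁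
  refine ⟨min p₀ p₁ / 2, by positivity, by linarith [min_le_right p₀ p₁], fun L₀ => ?_⟩
  obtain ⟨L₁, hL₁⟩ := hd (min p₀ p₁ / 2) (by positivity) (by linarith [min_le_left p₀ p₁])
  refine ⟨max L₀ L₁, le_max_left _ _, ?_⟩
  have := hL₁ (max L₀ L₁) (le_max_right _ _)
  linarith

theorem notSaturated_of_deficit (hdef : PinningEfficiencyDeficit) : NotSaturated :=
  notSaturated_iff_frequentDeficit.2 (frequentDeficit_of_deficit hdef)

/-- The route glue runs verbatim from `NotSaturated` in place of the crux. -/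
theorem closes_of_notSaturated (hNS : NotSaturated) (hSat : GaussianPinningSaturation)
    (hMoeb : MoebiusLimitExists) : _root_.Ising3DConformalLimit := by
  obtain ⟨ρ, Δ, S, hρ, hΔ, hlim, hnd, hmob⟩ := hMoeb
  refine ⟨ρ, Δ, S, hρ, hΔ, hlim, hnd, hmob, ?_⟩
  by_contra hU4
  exact hNS ((gaussianPinningSaturation_iff.1 hSat) ρ Δ S hρ hΔ hlim hnd hmob hU4)

/-- Conversely, given the two other items of `closes`, `NotSaturated` is NECESSARY: if the conjunct
fails while a Möbius limit exists, that limit is Gaussian off coincidences and r3 forces lattice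
saturation. Hence `NotSaturated` is exactly the weakest statement that can replace the crux in
this route (any admissible replacement `X` with `X → r3 → r5 → conjunct` satisfies
`X → r3 → r5 → NotSaturated ∨ conjunct`). -/
theorem latticeSaturation_of_not_conjunct (hSat : GaussianPinningSaturation)
    (hMoeb : MoebiusLimitExists) (hnot : ¬ _root_.Ising3DConformalLimit) : LatticeSaturation := by
  obtain ⟨ρ, Δ, S, hρ, hΔ, hlim, hnd, hmob⟩ := hMoeb
  have hU4 : ¬ HasNontrivialU4 S := fun h => hnot ⟨ρ, Δ, S, hρ, hΔ, hlim, hnd, hmob, h⟩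
  exact (gaussianPinningSaturation_iff.1 hSat) ρ Δ S hρ hΔ hlim hnd hmob hU4

/-- Packaging: given r3 and r5, the conjunct is EQUIVALENT to `NotSaturated ∨ conjunct`, i.e.
`NotSaturated` is the exact residual content the route asks of its rank-2 crux. -/
theorem conjunct_iff_notSaturated_or (hSat : GaussianPinningSaturation) (hMoeb : MoebiusLimitExists) :
    _root_.Ising3DConformalLimit ↔ NotSaturated ∨ _root_.Ising3DConformalLimit :=
  ⟨Or.inr, fun h => h.elim (fun hNS => closes_of_notSaturated hNS hSat hMoeb) id⟩

/-! ### 2. Decomposition / strengthening through the landed linear-benchmark split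

`e = e^{lin} − e^{gap}` (`plantedEff_eq_linEff_sub_gapEff stub_varianceSplit`), `e^{lin} ≤ 1`
(`stub_linEffLeOne`), `e^{gap} ≥ 0` (`gapEff_nonneg`). -/

/-- FLOOR ON THE NONLINEAR REGRESSION GAP: for `p` small and `L ≥ L₀(p)`, with `k = ⌈pn⌉`,
`e^{gap}_L(k) ≥ ε`, i.e. the planted `L²`-distance of `τ_P ↦ E⁺[M_L | σ_P = τ_P]` from the affine
functions of the pin values is at least `ε (n+1)(n−k+1)/k ≈ ε n/p` on average over uniform
`k`-subsets. (Census statement; modulo B2 it is equivalent to the crux, see below.) -/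
def GapEffFloor : Prop :=
  ∃ ε : ℝ, 0 < ε ∧ ∃ p₀ : ℝ, 0 < p₀ ∧ ∀ p : ℝ, 0 < p → p < p₀ → ∃ L₀ : ℕ, ∀ L ≥ L₀,
    ε ≤ gapEff L ⌈p * ((box 3 L).card : ℝ)⌉₊

/-- DEFICIT OF THE LINEAR BENCHMARK ITSELF (the other disjunct of the trivial split). -/
def LinEffDeficit : Prop :=
  ∃ ε : ℝ, 0 < ε ∧ ∃ p₀ : ℝ, 0 < p₀ ∧ ∀ p : ℝ, 0 < p → p < p₀ → ∃ L₀ : ℕ, ∀ L ≥ L₀,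
    linEff L ⌈p * ((box 3 L).card : ℝ)⌉₊ ≤ 1 - ε

/-- **Unconditional**: a floor on the regression-gap efficiency gives the crux
(`e = e^{lin} − e^{gap} ≤ 1 − ε`). -/
theorem deficit_of_gapEffFloor (h : GapEffFloor) : PinningEfficiencyDeficit := by
  rw [deficit_iff]
  obtain ⟨ε, hε, p₀, hp₀, h⟩ := h
  refine ⟨ε, hε, min p₀ 1, lt_min hp₀ one_pos, fun p hp hpp => ?_⟩
  obtain ⟨L₀, hL₀⟩ := h p hp (lt_of_lt_of_le hpp (min_le_left _ _))
  refine ⟨L₀, fun L hL => ?_⟩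
  have hk := ceil_mul_card_le (le_of_lt (lt_of_lt_of_le hpp (min_le_right _ _))) L
  have hgap := hL₀ L hL
  have hlin := stub_linEffLeOne L _ hk
  rw [plantedEff_eq_linEff_sub_gapEff stub_varianceSplit]
  linarith

/-- **Unconditional**: a deficit of the linear benchmark also gives the crux (`e ≤ e^{lin}`). -/
theorem deficit_of_linEffDeficit (h : LinEffDeficit) : PinningEfficiencyDeficit := by
  rw [deficit_iff]
  obtain ⟨ε, hε, p₀, hp₀, h⟩ := h
  refine ⟨ε, hε, min p₀ 1, lt_min hp₀ one_pos, fun p hp hpp => ?_⟩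
  obtain ⟨L₀, hL₀⟩ := h p hp (lt_of_lt_of_le hpp (min_le_left _ _))
  refine ⟨L₀, fun L hL => ?_⟩
  have hk := ceil_mul_card_le (le_of_lt (lt_of_lt_of_le hpp (min_le_right _ _))) L
  exact le_trans (plantedEff_le_linEff stub_varianceSplit L _ hk) (hL₀ L hL)

/-- … but that disjunct is DEAD modulo the registered Gaussian-side stub B2 of crux 8452
(`LinRiccatiSaturation`, the Bernoulli-trapping law of large numbers for the Schur complements of
the critical covariance): B2 gives `e^{lin} → 1` (`linSaturation_of_riccati`, with the landed
`stub_boxSusceptibilityFloor`). -/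
theorem not_linEffDeficit_of_riccati (h2 : LinRiccatiSaturation) : ¬ LinEffDeficit := by
  rintro ⟨ε, hε, p₀, hp₀, hd⟩
  obtain ⟨p₁, hp₁, hs⟩ := linSaturation_of_riccati h2 (ε / 2) (by linarith)
  have hmin : 0 < min p₀ p₁ := lt_min hp₀ hp₁
  obtain ⟨L₀, hL₀⟩ := hd (min p₀ p₁ / 2) (by positivity) (by linarith [min_le_left p₀ p₁])
  obtain ⟨L₁, hL₁⟩ := hs (min p₀ p₁ / 2) (by positivity) (by linarith [min_le_right p₀ p₁])
  have h₀ := hL₀ (max L₀ L₁) (le_max_left L₀ L₁)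
  have h₁ := hL₁ (max L₀ L₁) (le_max_right L₀ L₁)
  linarith

/-- **Converse modulo B2**: the crux and `LinRiccatiSaturation` give the gap floor (with `ε/2`).
So, modulo the Gaussian-side stub B2, `PinningEfficiencyDeficit ⟺ GapEffFloor`: the whole content
of the crux is a `p`-uniform floor on the NON-AFFINE part of the planted regression. -/
theorem gapEffFloor_of_deficit_of_riccati (hdef : PinningEfficiencyDeficit)
    (h2 : LinRiccatiSaturation) : GapEffFloor := by
  rw [deficit_iff] at hdef
  obtain ⟨ε, hε, p₀, hp₀, hd⟩ := hdef
  obtain ⟨p₁, hp₁, hs⟩ := linSaturation_of_riccati h2 (ε / 2) (by linarith)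
  refine ⟨ε / 2, by linarith, min p₀ p₁, lt_min hp₀ hp₁, fun p hp hpp => ?_⟩
  obtain ⟨L₀, hL₀⟩ := hd p hp (lt_of_lt_of_le hpp (min_le_left _ _))
  obtain ⟨L₁, hL₁⟩ := hs p hp (lt_of_lt_of_le hpp (min_le_right _ _))
  refine ⟨max L₀ L₁, fun L hL => ?_⟩
  have h₀ := hL₀ L (le_trans (le_max_left _ _) hL)
  have h₁ := hL₁ L (le_trans (le_max_right _ _) hL)
  rw [plantedEff_eq_linEff_sub_gapEff stub_varianceSplit] at h₀
  linarith

/-- The trivial two-disjunct split of the crux (recorded to show it is NOT a decomposition: one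
disjunct is dead modulo B2, the other is the crux modulo B2). -/
theorem deficit_of_linEffDeficit_or_gapEffFloor (h : LinEffDeficit ∨ GapEffFloor) :
    PinningEfficiencyDeficit :=
  h.elim deficit_of_linEffDeficit deficit_of_gapEffFloor

/-! ### 3. The Cauchy–Schwarz dual behind the "anticorrelation" split of the SPATIAL slack

For a probability vector `w` on a finite index set and observables `f, g`:
`Cov_w(f,g)² ≤ Var_w(f) · Var_w(g)`, so a SIGNED, `p`-uniform anticorrelation
`Cov_z(χ_z, m_z²) ≤ −a · sd_z(χ_z) sd_z(m_z²)` between the local conditional susceptibility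
`χ_z = Cov(M, σ_z | pins)` and the squared local magnetisation would floor the spatial variance of
`χ_z`, hence the SPATIAL term of the landed slack decomposition `csq − pvar²`
(`spatial_le_csq_sub_pvar_sq`). The abstract inequality is all that is provable now; the signed
`p`-uniform constant `a` is the crux's non-Gaussian content again (census `## Decomposition`). -/
theorem sq_wcov_le_wvar_mul_wvar {ι : Type*} (s : Finset ι) (w f g : ι → ℝ)
    (hw : ∀ i ∈ s, 0 ≤ w i) (a b : ℝ) :
    (∑ i ∈ s, w i * ((f i - a) * (g i - b))) ^ 2 ≤
      (∑ i ∈ s, w i * (f i - a) ^ 2) * ∑ i ∈ s, w i * (g i - b) ^ 2 := by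
  have key := Finset.sum_mul_sq_le_sq_mul_sq s (fun i => Real.sqrt (w i) * (f i - a))
    (fun i => Real.sqrt (w i) * (g i - b))
  have h1 : ∀ i ∈ s, Real.sqrt (w i) * (f i - a) * (Real.sqrt (w i) * (g i - b))
      = w i * ((f i - a) * (g i - b)) := by
    intro i hi
    have := Real.mul_self_sqrt (hw i hi)
    calc Real.sqrt (w i) * (f i - a) * (Real.sqrt (w i) * (g i - b))
        = (Real.sqrt (w i) * Real.sqrt (w i)) * ((f i - a) * (g i - b)) := by ring
      _ = w i * ((f i - a) * (g i - b)) := by rw [this]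
  have h2 : ∀ i ∈ s, (Real.sqrt (w i) * (f i - a)) ^ 2 = w i * (f i - a) ^ 2 := by
    intro i hi
    rw [mul_pow, Real.sq_sqrt (hw i hi)]
  have h3 : ∀ i ∈ s, (Real.sqrt (w i) * (g i - b)) ^ 2 = w i * (g i - b) ^ 2 := by
    intro i hi
    rw [mul_pow, Real.sq_sqrt (hw i hi)]
  rw [Finset.sum_congr rfl h1, Finset.sum_congr rfl h2, Finset.sum_congr rfl h3] at key
  exact key

/-- Dual form used by the split: if `Cov_w(f,g)² ≥ a² · Var_w(g) · V` with `Var_w(g) > 0`, then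
`Var_w(f) ≥ a² V` — the anticorrelation hypothesis must carry its own non-degeneracy
(`Var_w(g) > 0`), which is where a pointwise-in-`(P,τ)` version of the split already fails
(patterns with spatially constant `m_z²` give nothing). -/
theorem wvar_ge_of_sq_wcov_ge {ι : Type*} (s : Finset ι) (w f g : ι → ℝ)
    (hw : ∀ i ∈ s, 0 ≤ w i) (a b c V : ℝ)
    (hg : 0 < ∑ i ∈ s, w i * (g i - b) ^ 2)
    (h : c ^ 2 * (∑ i ∈ s, w i * (g i - b) ^ 2) * V
      ≤ (∑ i ∈ s, w i * ((f i - a) * (g i - b))) ^ 2) :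
    c ^ 2 * V ≤ ∑ i ∈ s, w i * (f i - a) ^ 2 := by
  have key := le_trans h (sq_wcov_le_wvar_mul_wvar s w f g hw a b)
  have : c ^ 2 * V * (∑ i ∈ s, w i * (g i - b) ^ 2)
      ≤ (∑ i ∈ s, w i * (f i - a) ^ 2) * ∑ i ∈ s, w i * (g i - b) ^ 2 := by
    calc c ^ 2 * V * (∑ i ∈ s, w i * (g i - b) ^ 2)
        = c ^ 2 * (∑ i ∈ s, w i * (g i - b) ^ 2) * V := by ring
      _ ≤ _ := key
  exact le_of_mul_le_mul_right this hg

/-! ### 4. Transfer / negation: the crux parametrised by dimension and inverse temperature -/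

/-- The crux's `let`-tower with `3 ↦ d` and `β_c(3) ↦ β`: planted-pinning efficiency deficit of the
`+` box `box d L` at inverse temperature `β`, field `0`. `DeficitAt 3 (criticalBeta 3)` is the crux
by `Iff.rfl`; `DeficitAt d (criticalBeta d)` for `d ≥ 5` is the (presumably FALSE, but open)
Gaussian-regime version; `DeficitAt 2 (criticalBeta 2)` the planar sibling (open in print);
`DeficitAt 3 β` for `β < β_c(3)` is TRUE for a trivial reason (finite susceptibility ⇒ `e → 0` as
`p → 0`), hence useless toward `β_c`. -/
def DeficitAt (d : ℕ) (β : ℝ) : Prop :=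
  let M : ℕ → SpinConfig (Site d) → ℝ := fun L σ => ∑ x ∈ box d L, spinAt x σ
  let cvar : ℕ → Finset (Site d) → SpinConfig (Site d) → ℝ := fun L P η =>
    isingExpect (zdGraph d) (box d L \ P) β 0 (.fixed η) (fun σ => M L σ ^ 2)
      - isingExpect (zdGraph d) (box d L \ P) β 0 (.fixed η) (M L) ^ 2
  let pvar : ℕ → ℕ → ℝ := fun L k =>
    (∑ P ∈ (box d L).powersetCard k, ∑ τ : ↥(box d L) → ℤˣ,
        isingWeight (zdGraph d) (box d L) β 0 .plus τ /
            isingPartitionFunction (zdGraph d) (box d L) β 0 .plus *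
          cvar L P (glue (box d L) τ .plus)) / ((box d L).card.choose k : ℝ)
  let eff : ℕ → ℕ → ℝ := fun L k =>
    (k : ℝ) * pvar L k / ((((box d L).card : ℝ) + 1) * (((box d L).card : ℝ) - k + 1))
  ∃ ε : ℝ, 0 < ε ∧ ∃ p₀ : ℝ, 0 < p₀ ∧ ∀ p : ℝ, 0 < p → p < p₀ → ∃ L₀ : ℕ, ∀ L ≥ L₀,
    eff L ⌈p * ((box d L).card : ℝ)⌉₊ ≤ 1 - ε

/-- The crux is the `d = 3`, `β = β_c(3)` instance (definitionally). -/
theorem deficitAt_three_iff : DeficitAt 3 (criticalBeta 3) ↔ PinningEfficiencyDeficit :=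
  Iff.rfl

/-- Dimension-UNIFORM version (the only form a dimension-blind argument could prove). It implies
the crux trivially; the census argues it is presumably false (`d ≥ 5` Gaussian regime), though
proving that needs the conditional-CLT mechanism of crux 8452 — no cheap counterexample either. -/
def DimensionUniformDeficit : Prop := ∀ d : ℕ, 3 ≤ d → DeficitAt d (criticalBeta d)

theorem deficit_of_dimensionUniform (h : DimensionUniformDeficit) : PinningEfficiencyDeficit :=
  deficitAt_three_iff.1 (h 3 le_rfl)

end Summit.CriticalPhenomena.Ising3DConformalLimit.Cruxes.PinningEfficiencyDeficit.StrategistS6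

end
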